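import Literature.Probability.LatticeModels.GinibreCharacterExpansion
import HarnessLib

/-!
# Bounds for the modified Bessel coefficients of the `U(1)` character expansion:
the ratio bound, Turán's inequality, and monotonicity in the order

Topic `Literature/Probability/LatticeModels`; companion of `GinibreCharacterExpansion.lean`, whose
`besselI m x = ∑_k (x/2)^{2k+|m|}/(k!(k+|m|)!)` are the Fourier (character) coefficients of the
`U(1)` Wilson plaquette weight, `e^{x cos θ} = ∑_m I_m(x) e^{imθ}` (Montvay–Münster 1994 §3.2.7
(3.171)–(3.172): `c_m(β) = I_m(β)/I_0(β)` after normalisation). Every weak- or strong-coupling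
expansion of the Wilson-action `U(1)` theory in the dual (integer-valued) variables needs
quantitative control of `m ↦ I_m(β)`; Fröhlich–Spencer 1982 (p. 433) single out "the analytical
subtleties of modified Bessel functions" as what separates the Wilson action from the Villain
action in their proof of the `U(1)₄` perimeter law. This file PROVES, from the power series alone
(no integral representation, no differential equation):

* `besselI_natCast_succ_le` — **the ratio bound** `I_{m+1}(x) ≤ x/(2(m+1)) · I_m(x)` (`x ≥ 0`,
  `m ≥ 0`; termwise), and `besselI_natCast_le_pow_div_factorial_mul` — the factorial bound
  `I_m(x) ≤ (x/2)^m/m! · I_0(x)`, i.e. `c_m(β) ≤ (β/2)^m/m!`.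
* **`besselI_pred_mul_succ_le_sq` — Turán's inequality** `I_{m-1}(x) I_{m+1}(x) ≤ I_m(x)²`
  (`x ≥ 0`, all integer orders `m ≥ 0`, with `I_{-1} = I_1` at `m = 0`), the inequality of
  Thiruvenkatachar–Nanjundiah (1951), i.e. **log-concavity of `m ↦ I_m(x)`**. Proof by total
  positivity (Karlin 1968, Ch. 8: Pólya frequency sequences are closed under convolution): with
  `a_n = (x/2)^n/n!` extended by `0` to `n < 0` (`expCoeff`), a `PF₂` sequence
  (`expCoeff_mul_expCoeff_succ_le`), one has the bilateral correlation representation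
  `I_j(x) = ∑_{k ∈ ℤ} a_k a_{k+j}` (`hasSum_expCoeff_mul_shift`), and the Binet–Cauchy
  symmetrisation
  `2(I_m² - I_{m+1}I_{m-1}) = ∑_{k,l ∈ ℤ} (a_k a_{l+1} - a_l a_{k+1})(a_{k+m}a_{l+1+m} - a_{k+1+m}a_{l+m})`
  exhibits the difference as a sum of products of two `2 × 2` minors of equal sign
  (`expCoeff_minor_mul_minor_nonneg`).
* Consequences: `besselI_one_le_besselI_zero`, **`besselI_natCast_succ_le_self`** (`m ↦ I_m(x)` is
  non-increasing on `m ≥ 0`: symmetry plus log-concavity), `besselI_le_of_natAbs_le`,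
  **`besselI_le_besselI_zero`** (`I_m ≤ I_0` for every `m ∈ ℤ`) and
  `besselI_div_besselI_zero_mem_Ioc`: the normalised character coefficients satisfy
  `0 < c_m(β) ≤ 1` for `β > 0`.

## References

* V. R. Thiruvenkatachar, T. S. Nanjundiah, *Inequalities concerning Bessel functions and
  orthogonal polynomials*, Proc. Indian Acad. Sci. Sect. A 33 (1951) 373–384 (the Turán-type
  inequality for `I_ν`). [ThiruvenkatacharNanjundiah1951]
* S. Karlin, *Total Positivity*, Vol. I (Stanford UP, 1968), Ch. 8 (Pólya frequency sequences;
  composition/convolution of totally positive kernels, Binet–Cauchy). [Karlin1968]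
* M. Abramowitz, I. A. Stegun, *Handbook of Mathematical Functions* (1964), 9.6.10 (the series
  defining `I_ν`). [AbramowitzStegun1964]
* I. Montvay, G. Münster, *Quantum Fields on a Lattice* (1994), §3.2.7 (3.171)–(3.172).
  [MontvayMunster1994]
* J. Fröhlich, T. Spencer, Comm. Math. Phys. 83 (1982) 411–454, p. 433. [FrohlichSpencerCMP1982]
-/

noncomputable section

namespace Literature.Probability.LatticeModels

open Finset Real Filter
open scoped BigOperators Nat Topology

/-! ### The ratio bound `I_{m+1}(x) ≤ x/(2(m+1)) · I_m(x)` from the power series -/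

/-- Consecutive Bessel terms of consecutive orders: `T_{m+1,k} = (x/2)/(k+m+1) · T_{m,k}`.
[folklore] -/
theorem besselITerm_natCast_succ (x : ℝ) (m k : ℕ) :
    besselITerm ((m + 1 : ℕ) : ℤ) x k = (x / 2) / (k + m + 1) * besselITerm (m : ℤ) x k := by
  simp only [besselITerm, Int.natAbs_natCast]
  have h1 : 2 * k + (m + 1) = (2 * k + m) + 1 := by ring
  have h2 : k + (m + 1) = (k + m) + 1 := by ring
  rw [h1, h2, pow_succ, Nat.factorial_succ]
  push_cast
  have hk : (0 : ℝ) < k ! := by exact_mod_cast Nat.factorial_pos k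
  have hkm : (0 : ℝ) < (k + m)! := by exact_mod_cast Nat.factorial_pos (k + m)
  field_simp

/-- `T_{m+1,k} ≤ (x/2)/(m+1) · T_{m,k}` for `x ≥ 0`. [folklore] -/
theorem besselITerm_natCast_succ_le {x : ℝ} (hx : 0 ≤ x) (m k : ℕ) :
    besselITerm ((m + 1 : ℕ) : ℤ) x k ≤ (x / 2) / (m + 1) * besselITerm (m : ℤ) x k := by
  rw [besselITerm_natCast_succ]
  have hT : 0 ≤ besselITerm (m : ℤ) x k := besselITerm_nonneg hx _ _
  refine mul_le_mul_of_nonneg_right ?_ hT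
  exact div_le_div_of_nonneg_left (by positivity) (by positivity) (by linarith)

/-- **The ratio bound** `I_{m+1}(x) ≤ x/(2(m+1)) · I_m(x)` (`x ≥ 0`, `m ≥ 0`), termwise from the
power series. [folklore] -/
theorem besselI_natCast_succ_le {x : ℝ} (hx : 0 ≤ x) (m : ℕ) :
    besselI ((m + 1 : ℕ) : ℤ) x ≤ x / (2 * (m + 1)) * besselI (m : ℤ) x := by
  have h1 := hasSum_besselITerm ((m + 1 : ℕ) : ℤ) x
  have h2 := (hasSum_besselITerm (m : ℤ) x).mul_left ((x / 2) / (m + 1))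
  have h := hasSum_le (fun k => besselITerm_natCast_succ_le hx m k) h1 h2
  calc besselI ((m + 1 : ℕ) : ℤ) x ≤ (x / 2) / (m + 1) * besselI (m : ℤ) x := h
    _ = x / (2 * (m + 1)) * besselI (m : ℤ) x := by rw [div_div]

/-- **The crude factorial bound** `I_m(x) ≤ (x/2)^m/m! · I_0(x)` (`x ≥ 0`): the normalised Wilson
character coefficients satisfy `c_m = I_m(β)/I_0(β) ≤ (β/2)^m/m!`. [cite: AbramowitzStegun1964, 9.6.10 (series of `I_ν`; termwise comparison)] -/
theorem besselI_natCast_le_pow_div_factorial_mul {x : ℝ} (hx : 0 ≤ x) (m : ℕ) :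
    besselI (m : ℤ) x ≤ (x / 2) ^ m / m ! * besselI 0 x := by
  induction m with
  | zero => simp
  | succ m ih =>
    have h0 : 0 ≤ x / (2 * (m + 1)) := by positivity
    calc besselI ((m + 1 : ℕ) : ℤ) x ≤ x / (2 * (m + 1)) * besselI (m : ℤ) x :=
          besselI_natCast_succ_le hx m
      _ ≤ x / (2 * (m + 1)) * ((x / 2) ^ m / m ! * besselI 0 x) :=
          mul_le_mul_of_nonneg_left ih h0
      _ = (x / 2) ^ (m + 1) / (m + 1)! * besselI 0 x := by
          rw [pow_succ, Nat.factorial_succ]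
          push_cast
          have hm : (0 : ℝ) < m ! := by exact_mod_cast Nat.factorial_pos m
          field_simp

/-! ### The exponential coefficients `a_n = t^n/n!` on `ℤ` and `I_m` as a correlation sum -/

/-- The Taylor coefficients of the exponential, extended by zero to negative indices:
`a_n = t^n/n!` for `n ≥ 0`, `a_n = 0` for `n < 0`. For `t = x/2` one has
`I_m(x) = ∑_{k ∈ ℤ} a_k a_{k+m}` (`hasSum_expCoeff_mul_shift`), the bilateral "autocorrelation"
form of the Bessel series used in the total-positivity proof of Turán's inequality. [folklore] -/
def expCoeff (t : ℝ) (n : ℤ) : ℝ :=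
  if 0 ≤ n then t ^ n.toNat / (n.toNat)! else 0

/-- `a_n = t^n/n!` on `ℕ`. [folklore] -/
theorem expCoeff_natCast (t : ℝ) (n : ℕ) : expCoeff t n = t ^ n / n ! := by
  simp [expCoeff]

/-- `a_n = 0` for `n < 0`. [folklore] -/
theorem expCoeff_of_neg (t : ℝ) {n : ℤ} (hn : n < 0) : expCoeff t n = 0 := by
  simp [expCoeff, not_le.2 hn]

/-- `a_n ≥ 0` for `t ≥ 0`. [folklore] -/
theorem expCoeff_nonneg {t : ℝ} (ht : 0 ≤ t) (n : ℤ) : 0 ≤ expCoeff t n := by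
  unfold expCoeff
  split_ifs
  · positivity
  · exact le_rfl

/-- **Log-concavity of `n ↦ t^n/n!` in Pólya-frequency (`PF₂`) form**: for `k ≤ l`,
`a_k a_{l+1} ≤ a_l a_{k+1}` (the ratios `a_{n+1}/a_n = t/(n+1)` decrease), including the
zero-extended negative indices. [folklore] -/
theorem expCoeff_mul_expCoeff_succ_le {t : ℝ} (ht : 0 ≤ t) {k l : ℤ} (hkl : k ≤ l) :
    expCoeff t k * expCoeff t (l + 1) ≤ expCoeff t l * expCoeff t (k + 1) := by
  by_cases hk : 0 ≤ k
  · obtain ⟨k', rfl⟩ := Int.eq_ofNat_of_zero_le hk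
    obtain ⟨l', rfl⟩ := Int.eq_ofNat_of_zero_le (hk.trans hkl)
    have hkl' : k' ≤ l' := by exact_mod_cast hkl
    have e1 : ((k' : ℤ) + 1) = ((k' + 1 : ℕ) : ℤ) := by push_cast; rfl
    have e2 : ((l' : ℤ) + 1) = ((l' + 1 : ℕ) : ℤ) := by push_cast; rfl
    rw [e1, e2, expCoeff_natCast, expCoeff_natCast, expCoeff_natCast, expCoeff_natCast,
      div_mul_div_comm, div_mul_div_comm, ← pow_add, ← pow_add,
      show k' + (l' + 1) = l' + (k' + 1) by ring]
    have hk0 : (0 : ℝ) < k' ! := by exact_mod_cast Nat.factorial_pos k'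
    have hl0 : (0 : ℝ) < l' ! := by exact_mod_cast Nat.factorial_pos l'
    refine div_le_div_of_nonneg_left (pow_nonneg ht _) (by positivity) ?_
    rw [Nat.factorial_succ, Nat.factorial_succ]
    push_cast
    have h1 : (k' : ℝ) + 1 ≤ l' + 1 := by exact_mod_cast Nat.succ_le_succ hkl'
    nlinarith [mul_pos hk0 hl0]
  · rw [expCoeff_of_neg t (not_le.1 hk), zero_mul]
    exact mul_nonneg (expCoeff_nonneg ht _) (expCoeff_nonneg ht _)

/-- On `ℕ` the products `a_k a_{k+m}` are the Bessel terms `T_{m,k}(2t)`. [folklore] -/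
theorem expCoeff_mul_expCoeff_natCast (t : ℝ) (m k : ℕ) :
    expCoeff t k * expCoeff t ((k : ℤ) + m) = besselITerm (m : ℤ) (2 * t) k := by
  have e : ((k : ℤ) + m) = ((k + m : ℕ) : ℤ) := by push_cast; ring
  rw [e, expCoeff_natCast, expCoeff_natCast]
  simp only [besselITerm, Int.natAbs_natCast]
  rw [show (2 : ℝ) * t / 2 = t by ring, div_mul_div_comm, ← pow_add,
    show k + (k + m) = 2 * k + m by ring]

/-- **`I_m` as a bilateral correlation sum**: `∑_{k ∈ ℤ} a_{k+s} a_{k+s+m} = I_m(2t)` for every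
shift `s ∈ ℤ` (`m ≥ 0`). [folklore] -/
theorem hasSum_expCoeff_mul_shift (t : ℝ) (m : ℕ) (s : ℤ) :
    HasSum (fun k : ℤ => expCoeff t (k + s) * expCoeff t (k + s + m)) (besselI (m : ℤ) (2 * t)) := by
  have h0 : HasSum (fun k : ℤ => expCoeff t k * expCoeff t (k + m)) (besselI (m : ℤ) (2 * t)) := by
    have hnat : HasSum (fun k : ℕ => expCoeff t (k : ℤ) * expCoeff t ((k : ℤ) + m))
        (besselI (m : ℤ) (2 * t)) := by
      simp_rw [expCoeff_mul_expCoeff_natCast]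
      exact hasSum_besselITerm _ _
    have hneg : HasSum (fun k : ℕ => expCoeff t (-((k : ℤ) + 1)) * expCoeff t (-((k : ℤ) + 1) + m)) 0 := by
      have : (fun k : ℕ => expCoeff t (-((k : ℤ) + 1)) * expCoeff t (-((k : ℤ) + 1) + m)) = 0 := by
        funext k
        rw [expCoeff_of_neg t (by omega), zero_mul]
        rfl
      rw [this]
      exact hasSum_zero
    have h := HasSum.of_nat_of_neg_add_one (f := fun k : ℤ => expCoeff t k * expCoeff t (k + m))
      hnat hneg
    rwa [add_zero] at h
  have h1 : (fun k : ℤ => expCoeff t (k + s) * expCoeff t (k + s + m)) =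
      (fun k : ℤ => expCoeff t k * expCoeff t (k + m)) ∘ (Equiv.addRight s) := by
    funext k
    simp only [Function.comp_apply, Equiv.coe_addRight]
  rw [h1]
  exact (Equiv.addRight s).hasSum_iff.2 h0

/-! ### Turán's inequality for `I_m` (Thiruvenkatachar–Nanjundiah) by total positivity -/

/-- The sign of the symmetrised Binet–Cauchy summand: for `PF₂` data both `2 × 2` minors have the
same sign. [folklore] -/
theorem expCoeff_minor_mul_minor_nonneg {t : ℝ} (ht : 0 ≤ t) (m : ℕ) (k l : ℤ) :
    0 ≤ (expCoeff t k * expCoeff t (l + 1) - expCoeff t l * expCoeff t (k + 1)) *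
      (expCoeff t (k + m) * expCoeff t (l + 1 + m) - expCoeff t (k + 1 + m) * expCoeff t (l + m)) := by
  rcases le_total k l with hkl | hlk
  · have hA := expCoeff_mul_expCoeff_succ_le ht hkl
    have hkl' : k + (m : ℤ) ≤ l + m := by omega
    have hB := expCoeff_mul_expCoeff_succ_le ht hkl'
    rw [show l + (m : ℤ) + 1 = l + 1 + m by ring, show k + (m : ℤ) + 1 = k + 1 + m by ring] at hB
    apply mul_nonneg_of_nonpos_of_nonpos <;> linarith
  · have hA := expCoeff_mul_expCoeff_succ_le ht hlk
    have hlk' : l + (m : ℤ) ≤ k + m := by omega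
    have hB := expCoeff_mul_expCoeff_succ_le ht hlk'
    rw [show l + (m : ℤ) + 1 = l + 1 + m by ring, show k + (m : ℤ) + 1 = k + 1 + m by ring] at hB
    apply mul_nonneg <;> linarith

/-- The fourth correlation sum: `∑_k a_{k+1} a_{k+m} = I_{m-1}(2t)` (for `m = 0` this is `I_1 = I_{-1}`).
[folklore] -/
theorem hasSum_expCoeff_succ_mul (t : ℝ) (m : ℕ) :
    HasSum (fun k : ℤ => expCoeff t (k + 1) * expCoeff t (k + m)) (besselI ((m : ℤ) - 1) (2 * t)) := by
  rcases Nat.eq_zero_or_pos m with rfl | hm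
  · -- `m = 0`: `∑ a_{k+1} a_k = I_1 = I_{-1}`
    have h := hasSum_expCoeff_mul_shift t 1 0
    simp only [add_zero, Nat.cast_one] at h
    have e : ((0 : ℕ) : ℤ) - 1 = -1 := by norm_num
    rw [e, besselI_neg_index]
    simp only [Nat.cast_zero, add_zero]
    convert h using 1
    funext k
    ring
  · obtain ⟨n, rfl⟩ := Nat.exists_eq_add_of_le hm
    have h := hasSum_expCoeff_mul_shift t n 1
    have e : ((1 + n : ℕ) : ℤ) - 1 = (n : ℤ) := by push_cast; ring
    rw [e]
    convert h using 1
    funext k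
    congr 1
    push_cast
    ring_nf

/-- **Turán's inequality for the modified Bessel functions** (Thiruvenkatachar–Nanjundiah 1951):
`I_{m-1}(x) I_{m+1}(x) ≤ I_m(x)²` for `x ≥ 0` and every integer order (stated for `m ≥ 0`; for
`m = 0` it reads `I_1² ≤ I_0²` by `I_{-1} = I_1`). Proof by total positivity: with `a_n = (x/2)^n/n!`
(zero for `n < 0`), `I_j(x) = ∑_{k ∈ ℤ} a_k a_{k+j}`; the Binet–Cauchy symmetrisation gives
`2 (I_m² - I_{m+1} I_{m-1}) = ∑_{k,l} (a_k a_{l+1} - a_l a_{k+1})(a_{k+m} a_{l+1+m} - a_{k+1+m} a_{l+m})`,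
a sum of products of two `2 × 2` minors of the Pólya-frequency sequence `a`, each of the same sign
(`expCoeff_minor_mul_minor_nonneg`). [cite: ThiruvenkatacharNanjundiah1951, Turán-type inequality for the modified Bessel functions of the first kind; proof here after Karlin1968, Ch. 8 (PF₂ sequences, Binet–Cauchy)] -/
theorem besselI_pred_mul_succ_le_sq {x : ℝ} (hx : 0 ≤ x) (m : ℕ) :
    besselI ((m : ℤ) - 1) x * besselI ((m : ℤ) + 1) x ≤ besselI (m : ℤ) x ^ 2 := by
  set t := x / 2 with ht_def
  have ht : 0 ≤ t := by positivity
  have hx2 : x = 2 * t := by rw [ht_def]; ring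
  rw [hx2]
  set a : ℤ → ℝ := expCoeff t with ha_def
  have ha0 : ∀ n, 0 ≤ a n := expCoeff_nonneg ht
  -- the four bilateral sums
  have hfF : HasSum (fun k : ℤ => a k * a (k + m)) (besselI (m : ℤ) (2 * t)) := by
    have h := hasSum_expCoeff_mul_shift t m 0
    simp only [add_zero] at h
    exact h
  have hgG : HasSum (fun k : ℤ => a (k + 1) * a (k + 1 + m)) (besselI (m : ℤ) (2 * t)) :=
    hasSum_expCoeff_mul_shift t m 1
  have hfG : HasSum (fun k : ℤ => a k * a (k + 1 + m)) (besselI ((m : ℤ) + 1) (2 * t)) := by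
    have h := hasSum_expCoeff_mul_shift t (m + 1) 0
    have e : ((m + 1 : ℕ) : ℤ) = (m : ℤ) + 1 := by push_cast; rfl
    rw [e] at h
    convert h using 1
    funext k
    simp only [add_zero]
    congr 2
    ring
  have hgF : HasSum (fun k : ℤ => a (k + 1) * a (k + m)) (besselI ((m : ℤ) - 1) (2 * t)) :=
    hasSum_expCoeff_succ_mul t m
  -- products of sums as double sums
  have hf0 : 0 ≤ fun k : ℤ => a k * a (k + m) := Pi.le_def.2 fun k => mul_nonneg (ha0 _) (ha0 _)
  have hg0 : 0 ≤ fun k : ℤ => a (k + 1) * a (k + 1 + m) :=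
    Pi.le_def.2 fun k => mul_nonneg (ha0 _) (ha0 _)
  have hF0 : 0 ≤ fun k : ℤ => a k * a (k + 1 + m) := Pi.le_def.2 fun k => mul_nonneg (ha0 _) (ha0 _)
  have hG0 : 0 ≤ fun k : ℤ => a (k + 1) * a (k + m) := Pi.le_def.2 fun k => mul_nonneg (ha0 _) (ha0 _)
  -- (no type ascription on the product summabilities: the summation-filter defaults must match)
  have hs1 := Summable.mul_of_nonneg hfF.summable hgG.summable hf0 hg0
  have hs2 := Summable.mul_of_nonneg hfG.summable hgF.summable hF0 hG0
  have P1 := hfF.mul hgG hs1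
  have P2 := hfG.mul hgF hs2
  have D := P1.sub P2
  have D' := (Equiv.prodComm ℤ ℤ).hasSum_iff.2 D
  have S := D.add D'
  -- the symmetrised summand is a product of two minors of the same sign
  set Φ : ℤ × ℤ → ℝ := fun p =>
    (a p.1 * a (p.2 + 1) - a p.2 * a (p.1 + 1)) *
      (a (p.1 + m) * a (p.2 + 1 + m) - a (p.1 + 1 + m) * a (p.2 + m)) with hΦ
  have hΦ0 : ∀ p, 0 ≤ Φ p := fun p => expCoeff_minor_mul_minor_nonneg ht m p.1 p.2
  have hSΦ : HasSum Φ ((besselI (m : ℤ) (2 * t) * besselI (m : ℤ) (2 * t) -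
      besselI ((m : ℤ) + 1) (2 * t) * besselI ((m : ℤ) - 1) (2 * t)) +
      (besselI (m : ℤ) (2 * t) * besselI (m : ℤ) (2 * t) -
      besselI ((m : ℤ) + 1) (2 * t) * besselI ((m : ℤ) - 1) (2 * t))) := by
    refine S.congr_fun fun p => ?_
    simp only [hΦ, Function.comp_apply, Equiv.prodComm_apply, Prod.fst_swap, Prod.snd_swap]
    ring
  have key := hSΦ.nonneg hΦ0
  have hX : 0 ≤ besselI (m : ℤ) (2 * t) * besselI (m : ℤ) (2 * t) -
      besselI ((m : ℤ) + 1) (2 * t) * besselI ((m : ℤ) - 1) (2 * t) := by linarith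
  calc besselI ((m : ℤ) - 1) (2 * t) * besselI ((m : ℤ) + 1) (2 * t)
      = besselI ((m : ℤ) + 1) (2 * t) * besselI ((m : ℤ) - 1) (2 * t) := mul_comm _ _
    _ ≤ besselI (m : ℤ) (2 * t) * besselI (m : ℤ) (2 * t) := by linarith
    _ = besselI (m : ℤ) (2 * t) ^ 2 := (sq _).symm

/-! ### Consequences: monotonicity in the order, `0 < c_m ≤ 1` -/

/-- `I_1(x) ≤ I_0(x)` (`x ≥ 0`). [folklore] -/
theorem besselI_one_le_besselI_zero {x : ℝ} (hx : 0 ≤ x) : besselI 1 x ≤ besselI 0 x := by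
  have h := besselI_pred_mul_succ_le_sq hx 0
  simp only [Nat.cast_zero, zero_sub, zero_add, besselI_neg_index] at h
  rw [← sq] at h
  exact (pow_le_pow_iff_left₀ (besselI_nonneg hx 1) (besselI_nonneg hx 0) two_ne_zero).1 h

/-- **`m ↦ I_m(x)` is non-increasing on `m ≥ 0`** (`x ≥ 0`): `I_{m+1}(x) ≤ I_m(x)` (log-concavity
and symmetry `I_{-m} = I_m` make the sequence unimodal with mode `0`). [folklore] -/
theorem besselI_natCast_succ_le_self {x : ℝ} (hx : 0 ≤ x) (m : ℕ) :
    besselI ((m + 1 : ℕ) : ℤ) x ≤ besselI (m : ℤ) x := by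
  induction m with
  | zero => simpa using besselI_one_le_besselI_zero hx
  | succ m ih =>
    rcases eq_or_lt_of_le hx with hx0 | hx'
    · rw [← hx0, besselI_zero_right, besselI_zero_right]
      have h1 : ((m + 1 + 1 : ℕ) : ℤ) ≠ 0 := by omega
      have h2 : ((m + 1 : ℕ) : ℤ) ≠ 0 := by omega
      rw [if_neg h1, if_neg h2]
    · have hT := besselI_pred_mul_succ_le_sq hx (m + 1)
      have e1 : ((m + 1 : ℕ) : ℤ) - 1 = (m : ℤ) := by push_cast; ring
      have e2 : ((m + 1 : ℕ) : ℤ) + 1 = ((m + 1 + 1 : ℕ) : ℤ) := by push_cast; ring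
      rw [e1, e2] at hT
      have hpos : 0 < besselI (m : ℤ) x := besselI_pos hx' _
      have h0 : 0 ≤ besselI ((m + 1 : ℕ) : ℤ) x := besselI_nonneg hx _
      have h1 : besselI ((m + 1 : ℕ) : ℤ) x ^ 2 ≤ besselI ((m + 1 : ℕ) : ℤ) x * besselI (m : ℤ) x := by
        rw [sq]; exact mul_le_mul_of_nonneg_left ih h0
      have h2 : besselI (m : ℤ) x * besselI ((m + 1 + 1 : ℕ) : ℤ) x ≤
          besselI (m : ℤ) x * besselI ((m + 1 : ℕ) : ℤ) x := by nlinarith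
      exact le_of_mul_le_mul_left h2 hpos

/-- **`I_m(x) ≤ I_0(x)` for every integer order** (`x ≥ 0`): the normalised Wilson character
coefficients `c_m = I_m(β)/I_0(β)` lie in `(0, 1]`. [folklore] -/
theorem besselI_le_besselI_zero {x : ℝ} (hx : 0 ≤ x) (m : ℤ) : besselI m x ≤ besselI 0 x := by
  have key : ∀ n : ℕ, besselI (n : ℤ) x ≤ besselI 0 x := fun n => by
    induction n with
    | zero => simp
    | succ n ih => exact (besselI_natCast_succ_le_self hx n).trans ih
  rcases Int.natAbs_eq m with h | h
  · rw [h]; exact key _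
  · rw [h, besselI_neg_index]; exact key _

/-- Monotonicity in the order along `|m|`: `I_m(x) ≤ I_n(x)` whenever `|n| ≤ |m|` (`x ≥ 0`). [folklore] -/
theorem besselI_le_of_natAbs_le {x : ℝ} (hx : 0 ≤ x) {m n : ℤ} (h : n.natAbs ≤ m.natAbs) :
    besselI m x ≤ besselI n x := by
  have hm : besselI m x = besselI (m.natAbs : ℤ) x := by
    rcases Int.natAbs_eq m with h' | h'
    · conv_lhs => rw [h']
    · conv_lhs => rw [h', besselI_neg_index]
  have hn : besselI n x = besselI (n.natAbs : ℤ) x := by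
    rcases Int.natAbs_eq n with h' | h'
    · conv_lhs => rw [h']
    · conv_lhs => rw [h', besselI_neg_index]
  rw [hm, hn]
  obtain ⟨j, hj⟩ := Nat.exists_eq_add_of_le h
  rw [hj]
  clear hm hn hj h
  induction j with
  | zero => simp
  | succ j ih =>
    calc besselI ((n.natAbs + (j + 1) : ℕ) : ℤ) x
        = besselI ((n.natAbs + j + 1 : ℕ) : ℤ) x := by rw [Nat.add_assoc]
      _ ≤ besselI ((n.natAbs + j : ℕ) : ℤ) x := besselI_natCast_succ_le_self hx _
      _ ≤ besselI (n.natAbs : ℤ) x := ih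

/-- The normalised character coefficient `c_m(β) = I_m(β)/I_0(β)` of the `U(1)` Wilson weight lies
in `(0, 1]` for `β > 0`. [folklore] -/
theorem besselI_div_besselI_zero_mem_Ioc {x : ℝ} (hx : 0 < x) (m : ℤ) :
    besselI m x / besselI 0 x ∈ Set.Ioc (0 : ℝ) 1 := by
  have h0 := besselI_pos hx 0
  exact ⟨div_pos (besselI_pos hx m) h0, (div_le_one h0).2 (besselI_le_besselI_zero hx.le m)⟩

end Literature.Probability.LatticeModels
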